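import Mathlib
import Literature.MathematicalPhysics.QuantumFieldTheory.Luscher2010.TrivializingMaps
import Literature.MathematicalPhysics.QuantumFieldTheory.Luscher2010.FlowActionSeries
import Summits.Ventures.LatticeQCDFlow.TrivializingMaps.UniformRadius
import Summits.Ventures.LatticeQCDFlow.TrivializingMaps.LinkPolynomials
import HarnessLib

/-!
# The Wilson action as a link polynomial: degree 4, plaquette support, anchored decomposition

HONEST FRAMING: exact (Metropolis-corrected) sampling algorithms for lattice gauge theory; figures of merit are
autocorrelation/cost numbers at stated couplings and volumes; no continuum-physics claim.

Lüscher, CMP 293 (2010) 899, §4.4 eq. (4.16)–(4.19): the Wilson plaquette action `S_W = ∑_p Re tr(1 - W_p)` and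
its images under `Δ` are polynomials in Wilson loops; eq. (5.3): the link "footprint" of the leading
generator.  On the tree's ambient configuration space this file proves, sorry-free:

* closure of the graded spaces `PD m A = polyL m ⊓ depOn A` (`LinkPolynomials`) under the complex / matrix
  operations entering a Wilson loop (`cxPart`, `matPart`: entries of `W(e)`, products, `ᴴ`, `Re tr`);
* `plaqRe_mem`: `Re tr(1 - W_p) ∈ PD 4 (plaqLinks p)`;
* `ambWilsonAction_eq_sum_anchorS`: `S_W = ∑_e anchorS e` with `anchorS (x,μ) = ∑_{ν>μ} Re tr(1 - W_p(x,μ,ν))`,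
  `anchorS e ∈ PD 4 (linkBall 1 e)` — the order-0 input of the anchored Lüscher recursion;
* `linkDeriv_ambWilsonAction_mem`: `∂_{e',X} S_W ∈ PD 4 (plaqNbhd e')` (a link derivative of the action only
  sees the plaquettes through that link), and the finite-sum rules `linkDeriv_finset_sum`, `linkLap_finset_sum`.

References: M. Lüscher, CMP 293 (2010) 899 [Luscher2010Trivializing, arXiv:0907.5491], §4.4, §5.1, App. A.
-/

namespace Summit.Ventures.LatticeQCDFlow.TrivializingMaps

open Literature.MathematicalPhysics.QuantumFieldTheory
open Literature.MathematicalPhysics.QuantumFieldTheory.Luscher2010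
open scoped Matrix Matrix.Norms.Frobenius ContDiff

noncomputable section

variable {d L n : ℕ} [NeZero L]

/-! ## §1. Finite-sum rules for `∂_{e,X}` and `Δ` -/

/-- `∂_{e,X}` of a finite sum of smooth functionals. [cite: Luscher2010Trivializing, App. A eq. (A.3)] -/
theorem linkDeriv_finset_sum (e : Edge d L) (X : Matrix (Fin n) (Fin n) ℂ) {ι : Type*} (s : Finset ι)
    (g : ι → AmbConfig d L n → ℝ) (hg : ∀ i ∈ s, ContDiff ℝ ∞ (g i)) :
    linkDeriv e X (fun W => ∑ i ∈ s, g i W) = fun W => ∑ i ∈ s, linkDeriv e X (g i) W := by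
  classical
  induction s using Finset.induction_on with
  | empty =>
      funext W
      simp only [Finset.sum_empty, linkDeriv, deriv_const]
  | insert a s ha ih =>
      have hg' : ∀ i ∈ s, ContDiff ℝ ∞ (g i) := fun i hi => hg i (Finset.mem_insert_of_mem hi)
      funext W
      simp only [Finset.sum_insert ha]
      rw [linkDeriv_add_of_differentiableAt e X
          ((hg a (Finset.mem_insert_self a s)).differentiable (by simp) W)
          ((ContDiff.sum fun i hi => hg' i hi).differentiable (by simp) W), ih hg']

/-- `Δ` of a finite sum of smooth functionals. [cite: Luscher2010Trivializing, §4.2 eq. (4.6)] -/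
theorem linkLap_finset_sum (B : SuBasis n) {ι : Type*} (s : Finset ι) (g : ι → AmbConfig d L n → ℝ)
    (hg : ∀ i ∈ s, ContDiff ℝ ∞ (g i)) :
    linkLap B (fun W => ∑ i ∈ s, g i W) = fun W => ∑ i ∈ s, linkLap B (g i) W := by
  classical
  induction s using Finset.induction_on with
  | empty =>
      funext W
      simp only [Finset.sum_empty, linkLap, linkDeriv, deriv_const, Finset.sum_const_zero, neg_zero]
  | insert a s ha ih =>
      have hg' : ∀ i ∈ s, ContDiff ℝ ∞ (g i) := fun i hi => hg i (Finset.mem_insert_of_mem hi)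
      funext W
      simp only [Finset.sum_insert ha]
      rw [linkLap_add_of_contDiff B (hg a (Finset.mem_insert_self a s)) (ContDiff.sum fun i hi => hg' i hi),
        ih hg']

/-! ## §2. Complex- and matrix-valued functionals with real coordinates in a submodule -/

/-- Complex-valued functionals whose real and imaginary parts lie in `P`. [folklore] -/
def cxPart (P : Submodule ℝ (AmbConfig d L n → ℝ)) : Submodule ℝ (AmbConfig d L n → ℂ) where
  carrier := {F | (fun W => (F W).re) ∈ P ∧ (fun W => (F W).im) ∈ P}
  add_mem' {F G} hF hG := by
    refine ⟨?_, ?_⟩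
    · have h : (fun W => ((F + G) W).re) = (fun W => (F W).re) + fun W => (G W).re := by
        funext W; simp
      rw [h]; exact P.add_mem hF.1 hG.1
    · have h : (fun W => ((F + G) W).im) = (fun W => (F W).im) + fun W => (G W).im := by
        funext W; simp
      rw [h]; exact P.add_mem hF.2 hG.2
  zero_mem' := by
    have h0 : (fun W : AmbConfig d L n => ((0 : AmbConfig d L n → ℂ) W).re) = 0 := by funext W; simp
    have h0' : (fun W : AmbConfig d L n => ((0 : AmbConfig d L n → ℂ) W).im) = 0 := by funext W; simp
    refine ⟨?_, ?_⟩
    · rw [h0]; exact P.zero_mem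
    · rw [h0']; exact P.zero_mem
  smul_mem' c {F} hF := by
    refine ⟨?_, ?_⟩
    · have h : (fun W => ((c • F) W).re) = c • fun W => (F W).re := by
        funext W; simp
      rw [h]; exact P.smul_mem c hF.1
    · have h : (fun W => ((c • F) W).im) = c • fun W => (F W).im := by
        funext W; simp
      rw [h]; exact P.smul_mem c hF.2

omit [NeZero L] in
/-- Products: degrees add. [folklore] -/
theorem cx_mul_mem {a b c : ℕ} (h : a + b ≤ c) {A : Set (Edge d L)} {F G : AmbConfig d L n → ℂ}
    (hF : F ∈ cxPart (PD a A)) (hG : G ∈ cxPart (PD b A)) : F * G ∈ cxPart (PD (n := n) c A) := by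
  refine ⟨?_, ?_⟩
  · have e : (fun W => ((F * G) W).re) =
        (fun W => (F W).re) * (fun W => (G W).re) - (fun W => (F W).im) * fun W => (G W).im := by
      funext W; simp [Complex.mul_re]
    rw [e]
    exact Submodule.sub_mem _ (mul_mem_PD h hF.1 hG.1) (mul_mem_PD h hF.2 hG.2)
  · have e : (fun W => ((F * G) W).im) =
        (fun W => (F W).re) * (fun W => (G W).im) + (fun W => (F W).im) * fun W => (G W).re := by
      funext W; simp [Complex.mul_im]
    rw [e]
    exact Submodule.add_mem _ (mul_mem_PD h hF.1 hG.2) (mul_mem_PD h hF.2 hG.1)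

omit [NeZero L] in
/-- Complex conjugation. [folklore] -/
theorem cx_star_mem {P : Submodule ℝ (AmbConfig d L n → ℝ)} {F : AmbConfig d L n → ℂ}
    (hF : F ∈ cxPart P) : (fun W => star (F W)) ∈ cxPart P := by
  refine ⟨?_, ?_⟩
  · have e : (fun W => (star (F W)).re) = fun W => (F W).re := by funext W; simp
    rw [e]; exact hF.1
  · have e : (fun W => (star (F W)).im) = -fun W => (F W).im := by funext W; simp
    rw [e]; exact P.neg_mem hF.2

omit [NeZero L] in
/-- Constants. [folklore] -/
theorem cx_const_mem (m : ℕ) (A : Set (Edge d L)) (c : ℂ) :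
    (fun _ : AmbConfig d L n => c) ∈ cxPart (PD (n := n) m A) :=
  ⟨const_mem_PD m A c.re, const_mem_PD m A c.im⟩

omit [NeZero L] in
/-- The entries `W ↦ W(e)_{ij}` of a link in `A` (degree 1). [folklore] -/
theorem cx_entry_mem {m : ℕ} (hm : 1 ≤ m) {A : Set (Edge d L)} {e : Edge d L} (he : e ∈ A) (i j : Fin n) :
    (fun W : AmbConfig d L n => W e i j) ∈ cxPart (PD m A) := by
  refine ⟨?_, ?_⟩
  · have h : (fun W : AmbConfig d L n => (W e i j).re) = lcoord (e, (i, j, true)) := by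
      funext W; simp only [lcoord, SUNBakryEmery.coordFn_true]
    rw [h]; exact lcoord_mem_PD hm (by exact he)
  · have h : (fun W : AmbConfig d L n => (W e i j).im) = lcoord (e, (i, j, false)) := by
      funext W; simp only [lcoord, SUNBakryEmery.coordFn_false]
    rw [h]; exact lcoord_mem_PD hm (by exact he)

/-- Matrix-valued functionals all of whose entries lie in `cxPart P`. [folklore] -/
def matPart (P : Submodule ℝ (AmbConfig d L n → ℝ)) :
    Submodule ℝ (AmbConfig d L n → Matrix (Fin n) (Fin n) ℂ) where
  carrier := {M | ∀ i j, (fun W => M W i j) ∈ cxPart P}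
  add_mem' {M M'} hM hM' i j := by
    have h : (fun W => (M + M') W i j) = (fun W => M W i j) + fun W => M' W i j := by
      funext W; simp
    rw [h]; exact (cxPart P).add_mem (hM i j) (hM' i j)
  zero_mem' i j := by
    have h : (fun W => (0 : AmbConfig d L n → Matrix (Fin n) (Fin n) ℂ) W i j) = 0 := by
      funext W; simp
    rw [h]; exact (cxPart P).zero_mem
  smul_mem' c {M} hM i j := by
    have h : (fun W => (c • M) W i j) = c • fun W => M W i j := by
      funext W; simp
    rw [h]; exact (cxPart P).smul_mem c (hM i j)

omit [NeZero L] in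
/-- The link variable `W ↦ W(e)`, `e ∈ A` (degree 1). [folklore] -/
theorem mat_link_mem {m : ℕ} (hm : 1 ≤ m) {A : Set (Edge d L)} {e : Edge d L} (he : e ∈ A) :
    (fun W : AmbConfig d L n => W e) ∈ matPart (PD m A) :=
  fun i j => cx_entry_mem hm he i j

omit [NeZero L] in
/-- Constant matrices. [folklore] -/
theorem mat_const_mem (m : ℕ) (A : Set (Edge d L)) (M₀ : Matrix (Fin n) (Fin n) ℂ) :
    (fun _ : AmbConfig d L n => M₀) ∈ matPart (PD (n := n) m A) :=
  fun i j => cx_const_mem m A (M₀ i j)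

omit [NeZero L] in
/-- Matrix products: degrees add. [folklore] -/
theorem mat_mul_mem {a b c : ℕ} (h : a + b ≤ c) {A : Set (Edge d L)}
    {M M' : AmbConfig d L n → Matrix (Fin n) (Fin n) ℂ} (hM : M ∈ matPart (PD a A))
    (hM' : M' ∈ matPart (PD b A)) : (fun W => M W * M' W) ∈ matPart (PD (n := n) c A) := by
  intro i j
  have e : (fun W => (M W * M' W) i j) = ∑ k, fun W => M W i k * M' W k j := by
    funext W; simp only [Matrix.mul_apply, Finset.sum_apply]
  rw [e]
  exact Submodule.sum_mem _ fun k _ => cx_mul_mem h (hM i k) (hM' k j)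

omit [NeZero L] in
/-- Conjugate transpose. [folklore] -/
theorem mat_conjTranspose_mem {P : Submodule ℝ (AmbConfig d L n → ℝ)}
    {M : AmbConfig d L n → Matrix (Fin n) (Fin n) ℂ} (hM : M ∈ matPart P) :
    (fun W => (M W)ᴴ) ∈ matPart P := by
  intro i j
  have e : (fun W => (M W)ᴴ i j) = fun W => star (M W j i) := by
    funext W; simp [Matrix.conjTranspose_apply]
  rw [e]; exact cx_star_mem (hM j i)

omit [NeZero L] in
/-- `Re tr` of a matrix functional with entries over `P` lies in `P`. [folklore] -/
theorem trace_re_mem {P : Submodule ℝ (AmbConfig d L n → ℝ)}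
    {M : AmbConfig d L n → Matrix (Fin n) (Fin n) ℂ} (hM : M ∈ matPart P) :
    (fun W => (M W).trace.re) ∈ P := by
  have e : (fun W => (M W).trace.re) = ∑ i, fun W => (M W i i).re := by
    funext W; simp only [Matrix.trace, Matrix.diag_apply, Complex.re_sum, Finset.sum_apply]
  rw [e]; exact Submodule.sum_mem _ fun i _ => (hM i i).1

/-! ## §3. The plaquette and the Wilson action -/

/-- The plaquette functional `Re tr(1 - W(x,μ) W(x+μ̂,ν) W(x+ν̂,μ)ᴴ W(x,ν)ᴴ)` on ambient configurations.
[cite: Luscher2010Trivializing, §4.4 eq. (4.16)] -/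
def plaqRe (x : Site d L) (μ ν : Fin d) (W : AmbConfig d L n) : ℝ :=
  ((1 : Matrix (Fin n) (Fin n) ℂ) - W (x, μ) * W (x.shift μ, ν) * (W (x.shift ν, μ))ᴴ * (W (x, ν))ᴴ).trace.re

omit [NeZero L] in
/-- **The plaquette is a link polynomial of degree `≤ 4` in its four links.**
[cite: Luscher2010Trivializing, §4.4 eq. (4.16)] -/
theorem plaqRe_mem (x : Site d L) (μ ν : Fin d) : plaqRe (n := n) x μ ν ∈ PD 4 (plaqLinks x μ ν) := by
  have h1 : (fun W : AmbConfig d L n => W (x, μ)) ∈ matPart (PD 1 (plaqLinks x μ ν)) :=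
    mat_link_mem le_rfl (by simp [plaqLinks])
  have h2 : (fun W : AmbConfig d L n => W (x.shift μ, ν)) ∈ matPart (PD 1 (plaqLinks x μ ν)) :=
    mat_link_mem le_rfl (by simp [plaqLinks])
  have h3 : (fun W : AmbConfig d L n => (W (x.shift ν, μ))ᴴ) ∈ matPart (PD 1 (plaqLinks x μ ν)) :=
    mat_conjTranspose_mem (mat_link_mem le_rfl (by simp [plaqLinks]))
  have h4 : (fun W : AmbConfig d L n => (W (x, ν))ᴴ) ∈ matPart (PD 1 (plaqLinks x μ ν)) :=
    mat_conjTranspose_mem (mat_link_mem le_rfl (by simp [plaqLinks]))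
  have hP : (fun W : AmbConfig d L n =>
      W (x, μ) * W (x.shift μ, ν) * (W (x.shift ν, μ))ᴴ * (W (x, ν))ᴴ) ∈ matPart (PD 4 (plaqLinks x μ ν)) :=
    mat_mul_mem (a := 3) (b := 1) (by norm_num)
      (mat_mul_mem (a := 2) (b := 1) (by norm_num) (mat_mul_mem (a := 1) (b := 1) (by norm_num) h1 h2) h3) h4
  have hsub := Submodule.sub_mem _ (mat_const_mem (n := n) 4 (plaqLinks x μ ν) 1) hP
  exact trace_re_mem hsub

omit [NeZero L] in
/-- The plaquettes through a link lie in its plaquette neighbourhood. [folklore] -/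
theorem plaqLinks_subset_plaqNbhd {x : Site d L} {μ ν : Fin d} (hμν : μ ≠ ν) {e : Edge d L}
    (he : e ∈ plaqLinks x μ ν) : plaqLinks x μ ν ⊆ plaqNbhd e :=
  fun _ he' => ⟨x, μ, ν, hμν, he, he'⟩

omit [NeZero L] in
/-- The first link of a plaquette belongs to it. [folklore] -/
theorem self_mem_plaqLinks (x : Site d L) (μ ν : Fin d) : (x, μ) ∈ plaqLinks x μ ν := by
  simp [plaqLinks]

omit [NeZero L] in
/-- Plaquette balls grow: `linkBall R e ⊆ linkBall (R+1) e`. [folklore] -/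
theorem linkBall_subset_succ (R : ℕ) (e : Edge d L) : linkBall R e ⊆ linkBall (R + 1) e := fun e' h => by
  simp only [linkBall, Set.mem_setOf_eq]
  exact ⟨e', h, Or.inl rfl⟩

omit [NeZero L] in
/-- The plaquette neighbourhood of a link of `linkBall R e` lies in `linkBall (R+1) e`. [folklore] -/
theorem plaqNbhd_subset_linkBall_succ (R : ℕ) {e e' : Edge d L} (h : e' ∈ linkBall R e) :
    plaqNbhd e' ⊆ linkBall (R + 1) e := fun e'' h'' => by
  simp only [linkBall, Set.mem_setOf_eq]
  exact ⟨e', h, Or.inr h''⟩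

omit [NeZero L] in
/-- Every link lies in each of its plaquette balls. [folklore] -/
theorem self_mem_linkBall : ∀ (R : ℕ) (e : Edge d L), e ∈ linkBall R e
  | 0, e => by simp [linkBall]
  | R + 1, e => linkBall_subset_succ R e (self_mem_linkBall R e)

omit [NeZero L] in
/-- `plaqNbhd e ⊆ linkBall 1 e`. [folklore] -/
theorem plaqNbhd_subset_linkBall_one (e : Edge d L) : plaqNbhd e ⊆ linkBall 1 e :=
  plaqNbhd_subset_linkBall_succ 0 (self_mem_linkBall 0 e)

omit [NeZero L] in
/-- A plaquette through `e` is a degree-4 polynomial supported in `plaqNbhd e`. [folklore] -/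
theorem plaqRe_mem_plaqNbhd {x : Site d L} {μ ν : Fin d} (hμν : μ ≠ ν) {e : Edge d L}
    (he : e ∈ plaqLinks x μ ν) : plaqRe (n := n) x μ ν ∈ PD 4 (plaqNbhd e) :=
  PD_mono le_rfl (plaqLinks_subset_plaqNbhd hμν he) (plaqRe_mem x μ ν)

/-- The plaquettes ANCHORED at the link `e = (x, μ)`: `∑_{ν > μ} Re tr(1 - W_p(x, μ, ν))`. [folklore] -/
def anchorS (e : Edge d L) (W : AmbConfig d L n) : ℝ :=
  ∑ ν ∈ Finset.univ.filter (fun ν => e.2 < ν), plaqRe e.1 e.2 ν W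

/-- **Anchored decomposition of the Wilson action**: `S_W = ∑_e anchorS e`. [cite: Luscher2010Trivializing, §4.4 eq. (4.16)] -/
theorem ambWilsonAction_eq_sum_anchorS :
    (ambWilsonAction : AmbConfig d L n → ℝ) = fun W => ∑ e : Edge d L, anchorS e W := by
  funext W
  simp only [ambWilsonAction, anchorS, plaqRe, Fintype.sum_prod_type, Finset.sum_filter]

omit [NeZero L] in
/-- `anchorS e ∈ PD 4 (linkBall 1 e)`. [folklore] -/
theorem anchorS_mem (e : Edge d L) : anchorS (n := n) e ∈ PD 4 (linkBall 1 e) := by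
  have h : anchorS (n := n) e = ∑ ν ∈ Finset.univ.filter (fun ν => e.2 < ν), plaqRe e.1 e.2 ν := by
    funext W; simp only [anchorS, Finset.sum_apply]
  rw [h]
  refine Submodule.sum_mem _ fun ν hν => ?_
  have hlt : e.2 < ν := (Finset.mem_filter.1 hν).2
  refine PD_mono le_rfl (plaqNbhd_subset_linkBall_one e) (plaqRe_mem_plaqNbhd (ne_of_lt hlt) ?_)
  obtain ⟨x, μ⟩ := e
  exact self_mem_plaqLinks x μ ν

/-- **The Wilson action is a link polynomial of degree `≤ 4`.** [cite: Luscher2010Trivializing, §4.4] -/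
theorem ambWilsonAction_mem_polyL : (ambWilsonAction : AmbConfig d L n → ℝ) ∈ polyL d L n 4 := by
  rw [ambWilsonAction_eq_sum_anchorS]
  have h : (fun W => ∑ e : Edge d L, anchorS e W) = ∑ e : Edge d L, anchorS (n := n) e := by
    funext W; simp only [Finset.sum_apply]
  rw [h]
  exact Submodule.sum_mem _ fun e _ => (anchorS_mem e).1

/-- The Wilson action is smooth on ambient configurations. [folklore] -/
theorem contDiff_ambWilsonAction : ContDiff ℝ ∞ (ambWilsonAction : AmbConfig d L n → ℝ) :=
  contDiff_of_mem_polyL ambWilsonAction_mem_polyL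

/-- `∂_{e',X}` of a plaquette: zero unless `e'` is one of its links, and then supported in `plaqNbhd e'`.
[cite: Luscher2010Trivializing, §5.1 eq. (5.3)] -/
theorem linkDeriv_plaqRe_mem (e' : Edge d L) (X : Matrix (Fin n) (Fin n) ℂ) {x : Site d L} {μ ν : Fin d}
    (hμν : μ ≠ ν) : linkDeriv e' X (plaqRe (n := n) x μ ν) ∈ PD 4 (plaqNbhd e') := by
  by_cases h : e' ∈ plaqLinks x μ ν
  · exact linkDeriv_mem_PD e' X (plaqRe_mem_plaqNbhd hμν h)
  · rw [linkDeriv_eq_zero_of_not_mem X (plaqRe_mem x μ ν).2 h]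
    exact const_mem_PD 4 _ 0

/-- `∂_{e',X} (anchorS e) ∈ PD 4 (plaqNbhd e')`. [folklore] -/
theorem linkDeriv_anchorS_mem (e' : Edge d L) (X : Matrix (Fin n) (Fin n) ℂ) (e : Edge d L) :
    linkDeriv e' X (anchorS (n := n) e) ∈ PD 4 (plaqNbhd e') := by
  have h := linkDeriv_finset_sum e' X (Finset.univ.filter (fun ν => e.2 < ν))
    (fun ν => plaqRe (n := n) e.1 e.2 ν) (fun ν _ => contDiff_of_mem_PD (plaqRe_mem e.1 e.2 ν))
  have ha : anchorS (n := n) e = fun W => ∑ ν ∈ Finset.univ.filter (fun ν => e.2 < ν), plaqRe e.1 e.2 ν W :=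
    rfl
  rw [ha, h]
  have hfn : (fun W => ∑ ν ∈ Finset.univ.filter (fun ν => e.2 < ν), linkDeriv e' X (plaqRe e.1 e.2 ν) W) =
      ∑ ν ∈ Finset.univ.filter (fun ν => e.2 < ν), linkDeriv e' X (plaqRe (n := n) e.1 e.2 ν) := by
    funext W; simp only [Finset.sum_apply]
  rw [hfn]
  exact Submodule.sum_mem _ fun ν hν => linkDeriv_plaqRe_mem e' X (ne_of_lt (Finset.mem_filter.1 hν).2)

/-- **A link derivative of the Wilson action only sees the plaquettes through that link**:
`∂_{e',X} S_W ∈ PD 4 (plaqNbhd e')`. [cite: Luscher2010Trivializing, §5.1 eq. (5.3)] -/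
theorem linkDeriv_ambWilsonAction_mem (e' : Edge d L) (X : Matrix (Fin n) (Fin n) ℂ) :
    linkDeriv e' X (ambWilsonAction : AmbConfig d L n → ℝ) ∈ PD 4 (plaqNbhd e') := by
  rw [ambWilsonAction_eq_sum_anchorS, linkDeriv_finset_sum e' X Finset.univ (fun e => anchorS e)
    (fun e _ => contDiff_of_mem_PD (anchorS_mem e))]
  have hfn : (fun W => ∑ e : Edge d L, linkDeriv e' X (anchorS e) W) =
      ∑ e : Edge d L, linkDeriv e' X (anchorS (n := n) e) := by
    funext W; simp only [Finset.sum_apply]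
  rw [hfn]
  exact Submodule.sum_mem _ fun e _ => linkDeriv_anchorS_mem e' X e

end

end Summit.Ventures.LatticeQCDFlow.TrivializingMaps
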